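import Literature.AlgebraicGeometry.HilbertScheme.HeisenbergFockSpace
import Mathlib.Data.Fintype.Pi
import Mathlib.Algebra.BigOperators.Fin
import Mathlib.Data.Nat.Factorial.Basic
import Mathlib.Data.Int.Interval
import Mathlib.Data.Fin.VecNotation
import Mathlib.Tactic.FinCases
import Mathlib.Tactic.Linarith
import HarnessLib

/-!
# Multi-point Heisenberg monomials `𝔮_{m₁}⋯𝔮_{m_k}(τ_{k*}γ)`, the normally ordered zero-modes
`Σ_{ℓ(λ)=k, |λ|=0} 𝔞_λ(τ_*γ)/λ^!` and the Virasoro operators `𝔏ₙ(γ)` (pure algebra)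

Layer `Literature/AlgebraicGeometry/HilbertScheme`; sequel of `HeisenbergFockSpace` (definitions and formal lemmas, NO
named facts).  The vocabulary in which Li–Qin–Wang's closed formula for the Chern character operators (IMRN 2002,
Thm. 4.6) and Lehn's formula for the derivative of a Heisenberg operator (Li–Qin–Wang, Math. Ann. 2002, Thm. 2.16 (iv))
are stated on the tree's carriers in the sequel `ChernCharacterWZeroModes`:

* `multiPointOp q mul C [m₁, …, m_k] γ` — the printed `𝔮_{m₁} ⋯ 𝔮_{m_k}(τ_{k*}γ) = Σⱼ 𝔮_{m₁}(γ_{j,1}) ⋯ 𝔮_{m_k}(γ_{j,k})`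
  for `τ_{k*}γ = Σⱼ γ_{j,1} ⊗ ⋯ ⊗ γ_{j,k}` the Künneth decomposition of the push-forward of `γ` along the small diagonal
  `τ_k : X → Xᵏ` (LQW IMRN p. 6; Math. Ann. Def. 2.9 (iii) for `k = 2`), rendered WITHOUT a Künneth package exactly as the
  prequel renders the two-point operators: through a Casimir element `C = Σᵢ eᵢ ⊗ εᵢ` of the pairing `⟨a, b⟩ = ∫ ab`
  (`IsCasimir`: `Σᵢ ⟨eᵢ, v⟩ εᵢ = v`) and the multiplication `mul` of the coefficient algebra, by the recursion
  `τ_{1*}γ = γ`, `τ_{k*}γ = Σᵢ τ_{(k−1)*}(γ εᵢ) ⊗ eᵢ`, i.e.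
  `𝔮_{m₁}⋯𝔮_{m_k}(τ_{k*}γ) = Σᵢ 𝔮_{m₁}⋯𝔮_{m_{k−1}}(τ_{(k−1)*}(γεᵢ)) ∘ 𝔮_{m_k}(eᵢ)`.
  DICTIONARY (why this is the printed tensor): for an EVEN Casimir element (`|eᵢ| + |εᵢ|` even — the Künneth components
  of the diagonal of a surface) and the Künneth pairing `⟨a₁⊗⋯⊗a_k, y₁⊗⋯⊗y_k⟩ = ± Πⱼ ∫ aⱼyⱼ` (Koszul sign), the tensor
  `T_k(γ)` of the recursion satisfies `⟨T_k(γ), y₁ ⊗ ⋯ ⊗ y_k⟩ = ∫_X γ y₁ ⋯ y_k` for all homogeneous `yⱼ` (induction on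
  `k`: the two signs `(−1)^{|eᵢ||Y|}`, `(−1)^{|εᵢ||Y|}` met when moving `εᵢ` past `Y = y₁⋯y_{k−1}` multiply to `+1`), which is
  the projection formula `∫_{Xᵏ} τ_{k*}(γ) · (y₁ × ⋯ × y_k) = ∫_X γ · τ_k^*(y₁ × ⋯ × y_k)` characterising `τ_{k*}γ` by
  Poincaré duality on `Xᵏ`.  For `k = 2` this is the prequel's convention: `multiPointOp q mul C [n, −n] γ` IS
  `transferTerm q C (mul γ) n = Σᵢ 𝔮ₙ(γεᵢ)𝔮₋ₙ(eᵢ)` (`multiPointOp_pair_eq_transferTerm`, by `rfl`), the term of Oberdieck's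
  transfer operator with which `ChernCharacterOperators.cupOperator_zero_eq_transferOp_super` PROVES Lehn's
  `𝔊₀(α) = −Σ_{n>0} 𝔮ₙ𝔮₋ₙ(τ_{2*}α)`.
* `genPartitions k p`, `partFactorial` — Li–Qin–Wang's generalized partitions `λ = (⋯(−2)^{m₋₂}(−1)^{m₋₁}1^{m₁}2^{m₂}⋯)`
  with `ℓ(λ) = Σ mᵢ = k` parts and `|λ| = Σ i mᵢ = 0`, as antitone `k`-tuples of non-zero `𝔮`-MODES (`𝔞ᵢ = 𝔮₋ᵢ`:
  LQW IMRN write `𝔞₋ₙ`, `n > 0`, for Nakajima's creation operator `𝔮ₙ`), cut off at `|mode| ≤ p` (see below), and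
  `λ^! = Πᵢ mᵢ!` (IMRN Def. 4.1).
* `zeroMode q mul C k γ = Σ_{ℓ(λ)=k, |λ|=0} (1/λ^!) 𝔞_λ(τ_*γ)` with `𝔞_λ(τ_*γ) = (Πᵢ 𝔞ᵢ^{mᵢ})(τ_{ℓ(λ)*}γ)`, the
  product "`⋯𝔞₋₂^{m₋₂}𝔞₋₁^{m₋₁}𝔞₁^{m₁}𝔞₂^{m₂}⋯`" in increasing order of `i` (IMRN Def. 4.1 (i)), i.e. `𝔮`-modes in
  DECREASING order (creation operators on the left: normally ordered); `−zeroMode q mul C (k+2) γ` is the right-hand side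
  of IMRN Thm. 4.6 for a surface with numerically trivial canonical class and trivial Euler class.
* `virasoroOp q mul C n γ = 𝔏ₙ(γ)` — LQW Math. Ann. (2.13): `½ Σ_{m∈ℤ} 𝔮ₘ𝔮_{n−m} τ_{2*}` for `n ≠ 0` and
  `Σ_{m>0} 𝔮ₘ𝔮₋ₘ τ_{2*}` for `n = 0` (IMRN p. 6: `𝔏ₙ = −½ Σ :𝔞ₘ𝔞_{n−m}: τ_{2*}` in the `𝔞`-convention — the same operator).

## Sources (read; PDF pages of the materialised texts)

* W.-P. Li, Z. Qin, W. Wang, *Hilbert schemes and W algebras*, IMRN 2002 (arXiv:math/0111047) [`LiQinWang2002W`]: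
  p. 6 ("`𝔞_{m₁} ⋯ 𝔞_{m_k}(τ_{k*}(α))` denotes `Σⱼ 𝔞_{m₁}(α_{j,1}) ⋯ 𝔞_{m_k}(α_{j,k})` when `τ_{k*}α = Σⱼ α_{j,1} ⊗ ⋯ ⊗
  α_{j,k}`"; "`𝔏ₙ = −½ · Σ_{m∈ℤ} :𝔞ₘ𝔞_{n−m}: τ_{2*}`"; "Let `:𝔞_{m₁}𝔞_{m₂}:` be `𝔞_{m₁}𝔞_{m₂}` when `m₁ ≤ m₂` and
  `𝔞_{m₂}𝔞_{m₁}` when `m₁ > m₂`"; "`𝔞₋ₙ(α)` (resp. `𝔞ₙ(α)`) as the creation (resp. annihilation) operator. We also set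
  `𝔞₀(α) = 0`"), Def. 4.1 p. 8 (verbatim in the docstrings below), Thm. 4.6 p. 10.
* W.-P. Li, Z. Qin, W. Wang, Math. Ann. 324 (2002) (arXiv:math/0009132) [`LiQinWang2002`]: Def. 2.9 (iii) p. 5
  ((2.13) and "the operator `𝔮ₘ𝔮_ℓ τ_{2*}(α)` stands for `Σⱼ 𝔮ₘ(α_{j,1})𝔮_ℓ(α_{j,2})`"), p. 5 ("`𝔏ₙ(α)` … homogeneous of
  bi-degree `(n, 2n + |α|)`").
* M. Lehn, Invent. Math. 136 (1999) [`Lehn1999`], §3.1 p. 8 (`δ = τ_{2*}` is "the linear map adjoint to the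
  cup-product map" — the Casimir reading).

## Rendering, cut-offs, junk values

All operators are TOTAL definitions on an arbitrary family `q : ℤ → V →ₗ End(Fock Φ)`; the printed sums over all modes
are locally finite on a Heisenberg representation and are rendered summand-wise, on `ℍₚ = ⨁ᵢ Φ p i`, by the finite
window `|mode| ≤ p` (`zeroMode`: a normally ordered monomial whose annihilation part removes more than `p` points, or —
since `|λ| = 0` — whose creation part adds more than `p`, kills `ℍₚ` by the bi-degree axiom) resp. `−p ≤ m ≤ n + p`,
`m ∉ {0, n}` (`virasoroOp`, `n ≠ 0`: the term `𝔮ₘ𝔮_{n−m}` is written larger-mode-first, which for `m + (n − m) = n ≠ 0`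
is the printed product up to the super-sign absorbed by the symmetric tensor `τ_{2*}γ`, and vanishes on `ℍₚ` when its
annihilating mode exceeds `p`; the two excluded values carry a factor `𝔮₀ = 0`).  Outside a Heisenberg representation
these are just some operators (junk, documented); `multiPointOp … [] = 0` is a junk value (no `0`-point insertion is
used).  Nothing here asserts anything about Hilbert schemes.

## Not here

The commutators of multi-point monomials (IMRN Lemma 3.2), `W`-algebra relations, vertex operators of arbitrary
conformal weight (Math. Ann. Def. 4.3); the geometric identities (sequel `ChernCharacterWZeroModes`).
-/

noncomputable section

open DirectSum TensorProduct

universe u v w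

namespace Literature.AlgebraicGeometry.HilbertScheme

variable {K : Type u} [Field K]
variable {V : Type v} [AddCommGroup V] [Module K V]

/-! ### Multi-point insertions `𝔮_{m₁} ⋯ 𝔮_{m_k}(τ_{k*}γ)` through a Casimir element -/

section MultiPoint

variable {F : Type w} [AddCommGroup F] [Module K F]

variable (K) in
/-- One step of the recursion `𝔮_{m₁}⋯𝔮_{m_k}(τ_{k*}γ) = Σᵢ 𝔮_{m₁}⋯𝔮_{m_{k−1}}(τ_{(k−1)*}(γ εᵢ)) ∘ 𝔮_{m_k}(eᵢ)`: from the
operator-valued linear map `G = 𝔮_{m₁}⋯𝔮_{m_{k−1}}(τ_{(k−1)*} ·)` and `Q = 𝔮_{m_k}`, the linear map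
`γ ↦ Σᵢ G(γ εᵢ) ∘ Q(eᵢ)` for `C = Σᵢ eᵢ ⊗ εᵢ` (the same bilinear shape as the prequel's `transferTerm`).
[cite: LiQinWang2002W, §3 p. 6 (the notation 𝔞_{m₁}⋯𝔞_{m_k}(τ_{k*}α))] -/
def insertionStep (mul : V →ₗ[K] V →ₗ[K] V) (C : V ⊗[K] V) (Q G : V →ₗ[K] Module.End K F) :
    V →ₗ[K] Module.End K F where
  toFun γ := TensorProduct.lift ((LinearMap.mul K (Module.End K F)).compl₁₂ (G ∘ₗ mul γ) Q).flip C
  map_add' γ γ' := by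
    induction C using TensorProduct.induction_on with
    | zero => simp only [map_zero, add_zero]
    | tmul e ε => simp
    | add x y hx hy =>
      simp only [map_add] at hx hy ⊢
      rw [hx, hy]
      abel
  map_smul' c γ := by
    induction C using TensorProduct.induction_on with
    | zero => simp only [map_zero, smul_zero]
    | tmul e ε => simp
    | add x y hx hy =>
      simp only [map_add, map_smul, RingHom.id_apply] at hx hy ⊢
      rw [hx, hy, smul_add]

/-- On a pure tensor `e ⊗ ε` the recursion step is `G(γε) ∘ Q(e)`. [cite: LiQinWang2002W, §3 p. 6] -/
@[simp]
theorem insertionStep_apply_tmul (mul : V →ₗ[K] V →ₗ[K] V) (e ε : V) (Q G : V →ₗ[K] Module.End K F) (γ : V) :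
    insertionStep K mul (e ⊗ₜ[K] ε) Q G γ = G (mul γ ε) * Q e := by
  simp [insertionStep]

/-- The recursion step is additive in the Casimir tensor. [cite: LiQinWang2002W, §3 p. 6] -/
theorem insertionStep_add_casimir (mul : V →ₗ[K] V →ₗ[K] V) (C C' : V ⊗[K] V) (Q G : V →ₗ[K] Module.End K F)
    (γ : V) : insertionStep K mul (C + C') Q G γ = insertionStep K mul C Q G γ + insertionStep K mul C' Q G γ := by
  simp [insertionStep]

variable (K) in
/-- The multi-point insertion with the modes listed in REVERSE order: `multiPointRev q mul C [m_k, …, m₁] γ =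
𝔮_{m₁} ⋯ 𝔮_{m_k}(τ_{k*}γ)` (structural recursion peeling the last operator `𝔮_{m_k}`; `[] ↦ 0` is a junk value).
[cite: LiQinWang2002W, §3 p. 6 (the notation 𝔞_{m₁}⋯𝔞_{m_k}(τ_{k*}α))] -/
def multiPointRev (q : ℤ → V →ₗ[K] Module.End K F) (mul : V →ₗ[K] V →ₗ[K] V) (C : V ⊗[K] V) :
    List ℤ → (V →ₗ[K] Module.End K F)
  | [] => 0
  | [m] => q m
  | m :: m' :: ms => insertionStep K mul C (q m) (multiPointRev q mul C (m' :: ms))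

variable (K) in
/-- **The `k`-point Heisenberg monomial `𝔮_{m₁} ⋯ 𝔮_{m_k}(τ_{k*}γ)`** ("`Σⱼ 𝔮_{m₁}(γ_{j,1}) ⋯ 𝔮_{m_k}(γ_{j,k})` when
`τ_{k*}γ = Σⱼ γ_{j,1} ⊗ ⋯ ⊗ γ_{j,k}`"), modes in reading order, rendered through the Casimir element `C` and the
multiplication `mul` of the coefficient algebra by `τ_{k*}γ = Σᵢ τ_{(k−1)*}(γεᵢ) ⊗ eᵢ` (module docstring: DICTIONARY).
[cite: LiQinWang2002W, §3 p. 6 (the notation 𝔞_{m₁}⋯𝔞_{m_k}(τ_{k*}α))] [cite: LiQinWang2002, Def. 2.9 (iii) p. 5] -/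
def multiPointOp (q : ℤ → V →ₗ[K] Module.End K F) (mul : V →ₗ[K] V →ₗ[K] V) (C : V ⊗[K] V) (modes : List ℤ) :
    V →ₗ[K] Module.End K F :=
  multiPointRev K q mul C modes.reverse

/-- One point: `𝔮ₘ(τ_{1*}γ) = 𝔮ₘ(γ)`. [cite: LiQinWang2002W, §3 p. 6] -/
@[simp]
theorem multiPointOp_singleton (q : ℤ → V →ₗ[K] Module.End K F) (mul : V →ₗ[K] V →ₗ[K] V) (C : V ⊗[K] V)
    (m : ℤ) : multiPointOp K q mul C [m] = q m :=
  rfl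

/-- Peeling the last operator: `𝔮_{m₁}⋯𝔮_{m_k}𝔮_{m}(τ_{(k+1)*}γ) = Σᵢ 𝔮_{m₁}⋯𝔮_{m_k}(τ_{k*}(γεᵢ)) ∘ 𝔮ₘ(eᵢ)` for a
non-empty mode list. [cite: LiQinWang2002W, §3 p. 6] -/
theorem multiPointOp_concat (q : ℤ → V →ₗ[K] Module.End K F) (mul : V →ₗ[K] V →ₗ[K] V) (C : V ⊗[K] V)
    (m₁ : ℤ) (ms : List ℤ) (m : ℤ) :
    multiPointOp K q mul C (m₁ :: ms ++ [m]) = insertionStep K mul C (q m) (multiPointOp K q mul C (m₁ :: ms)) := by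
  unfold multiPointOp
  rw [show (m₁ :: ms ++ [m]).reverse = m :: (m₁ :: ms).reverse by simp]
  obtain ⟨m', ms', h⟩ : ∃ m' ms', (m₁ :: ms).reverse = m' :: ms' := by
    cases h : (m₁ :: ms).reverse with
    | nil => simp at h
    | cons a l => exact ⟨a, l, rfl⟩
  rw [h]
  rfl

/-- Two points: `𝔮ₐ𝔮_b(τ_{2*}γ) = Σᵢ 𝔮ₐ(γεᵢ) ∘ 𝔮_b(eᵢ)` — on a pure tensor `e ⊗ ε`, `𝔮ₐ(γε) ∘ 𝔮_b(e)`.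
[cite: LiQinWang2002, Def. 2.9 (iii) p. 5] -/
theorem multiPointOp_pair_tmul (q : ℤ → V →ₗ[K] Module.End K F) (mul : V →ₗ[K] V →ₗ[K] V) (e ε : V) (a b : ℤ)
    (γ : V) : multiPointOp K q mul (e ⊗ₜ[K] ε) [a, b] γ = q a (mul γ ε) * q b e :=
  insertionStep_apply_tmul mul e ε (q b) (q a) γ

end MultiPoint

section Fock

variable {Φ : ℕ → ℕ → Type w} [∀ n i, AddCommGroup (Φ n i)] [∀ n i, Module K (Φ n i)]

/-- **The two-point monomial `𝔮ₙ𝔮₋ₙ(τ_{2*}γ)` is the prequel's transfer term** `Σᵢ 𝔮ₙ(γεᵢ)𝔮₋ₙ(eᵢ)` of the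
endomorphism `γ ∪ ·` (definitionally). [cite: Oberdieck2021, §3.2 (definition of T_Γ) p. 7]
[cite: LiQinWang2002, Def. 2.9 (iii) p. 5] -/
theorem multiPointOp_pair_eq_transferTerm (q : ℤ → V →ₗ[K] Module.End K (Fock Φ)) (mul : V →ₗ[K] V →ₗ[K] V)
    (C : V ⊗[K] V) (n : ℤ) (γ : V) :
    multiPointOp K q mul C [n, -n] γ = transferTerm K q C (mul γ) n :=
  rfl

/-! ### Generalized partitions and the normally ordered zero-modes -/

/-- **Li–Qin–Wang's generalized partitions of `0` with `k` parts, within the window `p`.**  "Let `λ = (⋯(−2)^{m₋₂}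
(−1)^{m₋₁}1^{m₁}2^{m₂}⋯)` be a generalized partition of the integer `n = Σᵢ i mᵢ` whose part `i ∈ ℤ` has multiplicity
`mᵢ`. Define `ℓ(λ) = Σᵢ mᵢ`, `|λ| = Σᵢ i mᵢ`": here those with `ℓ(λ) = k`, `|λ| = 0`, written as the antitone `k`-tuple of
their `𝔮`-MODES (the part `i` of `λ` is the operator `𝔞ᵢ = 𝔮₋ᵢ`, so the printed product `⋯𝔞₋₁^{m₋₁}𝔞₁^{m₁}⋯` in
increasing `i` lists `𝔮`-modes in decreasing order), non-zero (`𝔞₀ = 0`) and of absolute value `≤ p` (the window on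
`ℍₚ`, module docstring). [cite: LiQinWang2002W, Def. 4.1 (i) p. 8] -/
def genPartitions (k p : ℕ) : Finset (Fin k → ℤ) :=
  (Fintype.piFinset fun _ : Fin k ↦ (Finset.Icc (-(p : ℤ)) p).erase 0).filter
    fun f ↦ (∀ i j : Fin k, i ≤ j → f j ≤ f i) ∧ ∑ i, f i = 0

/-- Membership in `genPartitions`. [cite: LiQinWang2002W, Def. 4.1 (i) p. 8] -/
theorem mem_genPartitions {k p : ℕ} (f : Fin k → ℤ) :
    f ∈ genPartitions k p ↔
      (∀ i, f i ≠ 0 ∧ -(p : ℤ) ≤ f i ∧ f i ≤ p) ∧ (∀ i j : Fin k, i ≤ j → f j ≤ f i) ∧ ∑ i, f i = 0 := by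
  simp only [genPartitions, Finset.mem_filter, Fintype.mem_piFinset, Finset.mem_erase, Finset.mem_Icc, ne_eq]

/-- **`λ^! = Πᵢ mᵢ!`** for the generalized partition written as a tuple `f`: the product over the distinct values `v`
of `f` of the factorial of the multiplicity of `v`. [cite: LiQinWang2002W, Def. 4.1 (i) p. 8] -/
def partFactorial {k : ℕ} (f : Fin k → ℤ) : ℕ :=
  ∏ v ∈ Finset.univ.image f, (Finset.univ.filter fun i ↦ f i = v).card.factorial

/-- `λ^!` is positive. [cite: LiQinWang2002W, Def. 4.1 (i) p. 8] -/
theorem partFactorial_pos {k : ℕ} (f : Fin k → ℤ) : 0 < partFactorial f :=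
  Finset.prod_pos fun _ _ ↦ Nat.factorial_pos _

/-- A tuple with pairwise distinct entries has `λ^! = 1`. [cite: LiQinWang2002W, Def. 4.1 (i) p. 8] -/
theorem partFactorial_eq_one_of_injective {k : ℕ} {f : Fin k → ℤ} (hf : Function.Injective f) :
    partFactorial f = 1 := by
  refine Finset.prod_eq_one fun v hv ↦ ?_
  obtain ⟨i, -, rfl⟩ := Finset.mem_image.mp hv
  have : (Finset.univ.filter fun j ↦ f j = f i) = {i} := by
    ext j
    simp only [Finset.mem_filter, Finset.mem_univ, true_and, Finset.mem_singleton]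
    exact ⟨fun h ↦ hf h, fun h ↦ h ▸ rfl⟩
  rw [this, Finset.card_singleton, Nat.factorial_one]

variable (K) in
/-- **The normally ordered `k`-point zero-mode `Σ_{ℓ(λ)=k, |λ|=0} (1/λ^!) 𝔞_λ(τ_*γ)`**, with
"`𝔞_λ(τ_*α) = (Πᵢ (𝔞ᵢ)^{mᵢ})(τ_{ℓ(λ)*}α)` where the product `Πᵢ (𝔞ᵢ)^{mᵢ}` is understood to be
`⋯𝔞₋₂^{m₋₂}𝔞₋₁^{m₋₁}𝔞₁^{m₁}𝔞₂^{m₂}⋯`" (creation operators `𝔞₋ₙ = 𝔮ₙ` on the left), rendered on `ℍₚ` by the finite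
window `genPartitions k p`.  With `k + 2` points and a minus sign this is the right-hand side of Li–Qin–Wang's formula
`𝔊ₖ(α) = −Σ_{ℓ(λ)=k+2, |λ|=0} 𝔞_λ(τ_*α)/λ^!` for a surface with numerically trivial canonical class and trivial Euler
class (IMRN Thm. 4.6; sequel). [cite: LiQinWang2002W, Def. 4.1 (i) p. 8 and Thm. 4.6 p. 10] -/
def zeroMode (q : ℤ → V →ₗ[K] Module.End K (Fock Φ)) (mul : V →ₗ[K] V →ₗ[K] V) (C : V ⊗[K] V) (k : ℕ) (γ : V) :
    Module.End K (Fock Φ) :=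
  DirectSum.toModule K ℕ (Fock Φ) fun p ↦
    (∑ f ∈ genPartitions k p, ((partFactorial f : K)⁻¹) • multiPointOp K q mul C (List.ofFn f) γ) ∘ₗ
      Fock.ofSummand K Φ p

/-- The zero-mode on the summand `ℍₚ`: the finite sum over the window `p`. [cite: LiQinWang2002W, Def. 4.1 (i) p. 8] -/
theorem zeroMode_apply_ofSummand (q : ℤ → V →ₗ[K] Module.End K (Fock Φ)) (mul : V →ₗ[K] V →ₗ[K] V)
    (C : V ⊗[K] V) (k : ℕ) (γ : V) (p : ℕ) (x : FockSummand Φ p) :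
    zeroMode K q mul C k γ (Fock.ofSummand K Φ p x) =
      ∑ f ∈ genPartitions k p, ((partFactorial f : K)⁻¹) • multiPointOp K q mul C (List.ofFn f) γ
        (Fock.ofSummand K Φ p x) := by
  simp only [zeroMode, DirectSum.toModule_lof, LinearMap.coe_comp, Function.comp_apply, LinearMap.coe_sum,
    Finset.sum_apply, LinearMap.smul_apply]

/-- **The generalized partitions of `0` with two parts** within the window `p` are exactly `(m, −m)`, `1 ≤ m ≤ p`
(as `𝔮`-modes: `𝔞₋ₘ𝔞ₘ = 𝔮ₘ𝔮₋ₘ`). [cite: LiQinWang2002W, Def. 4.1 (i) p. 8] -/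
theorem mem_genPartitions_two {p : ℕ} (f : Fin 2 → ℤ) :
    f ∈ genPartitions 2 p ↔ ∃ m : ℕ, 1 ≤ m ∧ m ≤ p ∧ f = ![(m : ℤ), -(m : ℤ)] := by
  rw [mem_genPartitions]
  constructor
  · rintro ⟨h1, h2, h3⟩
    rw [Fin.sum_univ_two] at h3
    have h01 : f 1 ≤ f 0 := h2 0 1 (Fin.zero_le _)
    have h0 : 0 < f 0 := by
      rcases lt_or_gt_of_ne (h1 0).1 with h | h
      · exfalso; linarith
      · exact h
    refine ⟨(f 0).toNat, by omega, ?_, ?_⟩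
    · have := (h1 0).2.2; omega
    · ext i
      fin_cases i
      · simp only [Fin.zero_eta, Matrix.cons_val_zero]; omega
      · simp only [Fin.mk_one, Matrix.cons_val_one, Matrix.cons_val_zero]; omega
  · rintro ⟨m, hm1, hmp, rfl⟩
    refine ⟨fun i ↦ ?_, fun i j hij ↦ ?_, by simp⟩
    · fin_cases i
      · simp only [Fin.zero_eta, Matrix.cons_val_zero]; omega
      · simp only [Fin.mk_one, Matrix.cons_val_one, Matrix.cons_val_zero]; omega
    · fin_cases i <;> fin_cases j
      · exact le_rfl
      · simp only [Fin.zero_eta, Matrix.cons_val_zero, Fin.mk_one, Matrix.cons_val_one]; omega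
      · exact absurd hij (by decide)
      · exact le_rfl

/-- **Two points: the zero-mode `Σ_{ℓ(λ)=2, |λ|=0} 𝔞_λ(τ_*γ)/λ^! = Σ_{m=1}^{p} 𝔮ₘ𝔮₋ₘ(τ_{2*}γ)` on `ℍₚ`** — Li–Qin–Wang's
`𝔏₀(γ)` / minus Oberdieck's transfer term sum. [cite: LiQinWang2002W, Def. 4.1 (i) p. 8 and proof of Thm. 4.7
(𝔊₀(α) = −𝔏₀(α) = −Σ_{ℓ(λ)=2,|λ|=0} 𝔞_λ(τ_*α)/λ^!) p. 11] -/
theorem zeroMode_two_apply_ofSummand (q : ℤ → V →ₗ[K] Module.End K (Fock Φ)) (mul : V →ₗ[K] V →ₗ[K] V)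
    (C : V ⊗[K] V) (γ : V) (p : ℕ) (x : FockSummand Φ p) :
    zeroMode K q mul C 2 γ (Fock.ofSummand K Φ p x) =
      ∑ m ∈ Finset.Icc 1 p, transferTerm K q C (mul γ) (m : ℤ) (Fock.ofSummand K Φ p x) := by
  rw [zeroMode_apply_ofSummand]
  refine Finset.sum_nbij' (fun f ↦ (f 0).toNat) (fun m ↦ ![(m : ℤ), -(m : ℤ)]) ?_ ?_ ?_ ?_ ?_
  · intro f hf
    obtain ⟨m, hm1, hmp, rfl⟩ := (mem_genPartitions_two f).mp hf
    simpa using And.intro hm1 hmp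
  · intro m hm
    rw [Finset.mem_Icc] at hm
    exact (mem_genPartitions_two _).mpr ⟨m, hm.1, hm.2, rfl⟩
  · intro f hf
    obtain ⟨m, -, -, rfl⟩ := (mem_genPartitions_two f).mp hf
    simp
  · intro m _
    simp
  · intro f hf
    obtain ⟨m, hm1, -, rfl⟩ := (mem_genPartitions_two f).mp hf
    have hinj : Function.Injective ![(m : ℤ), -(m : ℤ)] := by
      intro i j hij
      fin_cases i <;> fin_cases j
      · rfl
      · simp only [Fin.zero_eta, Matrix.cons_val_zero, Fin.mk_one, Matrix.cons_val_one] at hij; omega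
      · simp only [Fin.zero_eta, Matrix.cons_val_zero, Fin.mk_one, Matrix.cons_val_one] at hij; omega
      · rfl
    rw [partFactorial_eq_one_of_injective hinj, Nat.cast_one, inv_one, one_smul]
    simp only [Matrix.cons_val_zero, Int.toNat_natCast]
    rw [show List.ofFn ![(m : ℤ), -(m : ℤ)] = [(m : ℤ), -(m : ℤ)] by simp [List.ofFn_succ],
      multiPointOp_pair_eq_transferTerm]

/-- **`Σ_{ℓ(λ)=2, |λ|=0} 𝔞_λ(τ_*γ)/λ^! = −T(γ ∪ ·)`** (transfer exponent `t = 1`): the two-point case of the zero-mode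
is minus Oberdieck's transfer operator of left multiplication by `γ` — the form in which the prequels PROVE Lehn's
`𝔊₀(α) = −𝔏₀(α)` (`ChernCharacterOperators.cupOperator_zero_eq_transferOp_super`). [cite: LiQinWang2002W, proof of
Thm. 4.7 p. 11] [cite: Oberdieck2021, §3.1 (e_α) and §3.2 p. 6–7] -/
theorem zeroMode_two_eq_neg_transferOp (q : ℤ → V →ₗ[K] Module.End K (Fock Φ)) (mul : V →ₗ[K] V →ₗ[K] V)
    (C : V ⊗[K] V) (γ : V) : zeroMode K q mul C 2 γ = -transferOp K q C 1 (mul γ) := by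
  refine DirectSum.linearMap_ext K fun p ↦ LinearMap.ext fun x ↦ ?_
  rw [LinearMap.comp_apply, LinearMap.comp_apply, LinearMap.neg_apply]
  change zeroMode K q mul C 2 γ (Fock.ofSummand K Φ p x) = -transferOp K q C 1 (mul γ) (Fock.ofSummand K Φ p x)
  rw [zeroMode_two_apply_ofSummand, transferOp_apply_ofSummand, neg_neg]
  refine Finset.sum_congr rfl fun m _ ↦ ?_
  rw [sub_self, zpow_zero, one_smul]

/-! ### The Virasoro operators `𝔏ₙ(γ)` -/

variable (K) in
/-- The two-point monomial written larger-mode-first, `𝔮_{max(a,b)} 𝔮_{min(a,b)}(τ_{2*}γ)` (IMRN: "`:𝔞_{m₁}𝔞_{m₂}:` is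
`𝔞_{m₁}𝔞_{m₂}` when `m₁ ≤ m₂` and `𝔞_{m₂}𝔞_{m₁}` when `m₁ > m₂`", `𝔞ᵢ = 𝔮₋ᵢ`). [cite: LiQinWang2002W, §3 p. 6] -/
def normalOrderedPair (q : ℤ → V →ₗ[K] Module.End K (Fock Φ)) (mul : V →ₗ[K] V →ₗ[K] V) (C : V ⊗[K] V)
    (a b : ℤ) : V →ₗ[K] Module.End K (Fock Φ) :=
  if b ≤ a then multiPointOp K q mul C [a, b] else multiPointOp K q mul C [b, a]

variable (K) in
/-- **The Virasoro operator `𝔏ₙ(γ)`** (LQW Math. Ann. (2.13)): "`𝔏ₙ = ½ · Σ_{m ∈ ℤ} 𝔮ₘ𝔮_{n−m} τ_{2*}` if `n ≠ 0`;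
`Σ_{m > 0} 𝔮ₘ𝔮₋ₘ τ_{2*}` if `n = 0`" (IMRN: `𝔏ₙ = −½ Σ :𝔞ₘ𝔞_{n−m}: τ_{2*}`), of bi-degree `(n, 2n + |γ|)`; rendered on
`ℍₚ` by the finite windows `1 ≤ m ≤ p` (`n = 0`) and `−p ≤ m ≤ n + p`, `m ∉ {0, n}`, terms larger-mode-first (module
docstring). [cite: LiQinWang2002, Def. 2.9 (iii) (2.13) p. 5] [cite: LiQinWang2002W, §3 p. 6] -/
def virasoroOp (q : ℤ → V →ₗ[K] Module.End K (Fock Φ)) (mul : V →ₗ[K] V →ₗ[K] V) (C : V ⊗[K] V) (n : ℤ) (γ : V) :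
    Module.End K (Fock Φ) :=
  DirectSum.toModule K ℕ (Fock Φ) fun p ↦
    (if n = 0 then ∑ m ∈ Finset.Icc 1 p, multiPointOp K q mul C [(m : ℤ), -(m : ℤ)] γ
      else (2 : K)⁻¹ • ∑ m ∈ ((Finset.Icc (-(p : ℤ)) (n + p)).erase 0).erase n,
        normalOrderedPair K q mul C m (n - m) γ) ∘ₗ Fock.ofSummand K Φ p

/-- `𝔏₀(γ)` on `ℍₚ`: `Σ_{m=1}^{p} 𝔮ₘ𝔮₋ₘ(τ_{2*}γ)`. [cite: LiQinWang2002, Def. 2.9 (iii) (2.13) p. 5] -/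
theorem virasoroOp_zero_apply_ofSummand (q : ℤ → V →ₗ[K] Module.End K (Fock Φ)) (mul : V →ₗ[K] V →ₗ[K] V)
    (C : V ⊗[K] V) (γ : V) (p : ℕ) (x : FockSummand Φ p) :
    virasoroOp K q mul C 0 γ (Fock.ofSummand K Φ p x) =
      ∑ m ∈ Finset.Icc 1 p, transferTerm K q C (mul γ) (m : ℤ) (Fock.ofSummand K Φ p x) := by
  simp only [virasoroOp, DirectSum.toModule_lof, LinearMap.coe_comp, Function.comp_apply, if_true,
    LinearMap.coe_sum, Finset.sum_apply, multiPointOp_pair_eq_transferTerm]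

/-- `𝔏ₙ(γ)`, `n ≠ 0`, on `ℍₚ`: `½ Σ_{−p ≤ m ≤ n+p, m ∉ {0,n}} 𝔮_{max}𝔮_{min}(τ_{2*}γ)` over the pairs `{m, n − m}`.
[cite: LiQinWang2002, Def. 2.9 (iii) (2.13) p. 5] -/
theorem virasoroOp_apply_ofSummand_of_ne_zero (q : ℤ → V →ₗ[K] Module.End K (Fock Φ))
    (mul : V →ₗ[K] V →ₗ[K] V) (C : V ⊗[K] V) {n : ℤ} (hn : n ≠ 0) (γ : V) (p : ℕ) (x : FockSummand Φ p) :
    virasoroOp K q mul C n γ (Fock.ofSummand K Φ p x) =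
      (2 : K)⁻¹ • ∑ m ∈ ((Finset.Icc (-(p : ℤ)) (n + p)).erase 0).erase n,
        normalOrderedPair K q mul C m (n - m) γ (Fock.ofSummand K Φ p x) := by
  simp only [virasoroOp, DirectSum.toModule_lof, LinearMap.coe_comp, Function.comp_apply, hn, if_false,
    LinearMap.smul_apply, LinearMap.coe_sum, Finset.sum_apply]

/-- **`𝔏₀(γ) = Σ_{ℓ(λ)=2,|λ|=0} 𝔞_λ(τ_*γ)/λ^!`**: the `n = 0` Virasoro operator is the two-point zero-mode (both are
`Σ_{m>0} 𝔮ₘ𝔮₋ₘ(τ_{2*}γ)`), hence `𝔏₀(γ) = −T(γ ∪ ·)` (`zeroMode_two_eq_neg_transferOp`) — so Lehn's `𝔊₀(γ) = −𝔏₀(γ)`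
(LQW (5.6), Thm. 5.13 (iv)) reads `𝔊₀(γ) = T(γ ∪ ·) = −zeroMode 2 γ`.
[cite: LiQinWang2002, (2.13) p. 5 and Thm. 5.13 (iv) p. 13] [cite: LiQinWang2002W, proof of Thm. 4.7 p. 11] -/
theorem virasoroOp_zero_eq_zeroMode_two (q : ℤ → V →ₗ[K] Module.End K (Fock Φ)) (mul : V →ₗ[K] V →ₗ[K] V)
    (C : V ⊗[K] V) (γ : V) : virasoroOp K q mul C 0 γ = zeroMode K q mul C 2 γ := by
  refine DirectSum.linearMap_ext K fun p ↦ LinearMap.ext fun x ↦ ?_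
  rw [LinearMap.comp_apply, LinearMap.comp_apply]
  change virasoroOp K q mul C 0 γ (Fock.ofSummand K Φ p x) = zeroMode K q mul C 2 γ (Fock.ofSummand K Φ p x)
  rw [virasoroOp_zero_apply_ofSummand, zeroMode_two_apply_ofSummand]

end Fock

end Literature.AlgebraicGeometry.HilbertScheme

end
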